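/-
Copyright (c) 2026. All rights reserved.
Released under Apache 2.0 license as described in the file LICENSE.
Authors: abc-iut cell, wave-W6 cone seat abc-iut-w6-d021 (proof-only).
-/
import Mathlib.CategoryTheory.Equivalence
import Literature.IUT.HodgeArakelov.RadialGraphs
import Literature.IUT.HodgeArakelov.GaloisPairRigidityReadings
import HarnessLib

/-!
# [IUTchII] Example 1.9 (iv): discharge census of the printed clauses (proof-only companion)

S. Mochizuki, *Inter-universal Teichmüller theory II*, §1, Example 1.9 (iv), kurims manuscript (Dec. 2020)
p. 43 line 17 – p. 44 line 19 (read on the page). PROOF-ONLY companion of abc-iut-L6-t1's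
`Literature/IUT/HodgeArakelov/RadialGraphs.lean` (p406616), which types Example 1.9 as REAL category
theory over Mathlib (the graph `𝒢` of a functor, the daggered environment `(ℛ†, 𝒞† := 𝒞, Φ†)`, the
natural functor `Ψ_ℛ : ℛ → ℛ†`). Nothing typed there is edited or restated here (DEFS-FREEZE); no `def`,
no `instance`. Node id `IUTchII:Ex1.9(iv)` of plan/DAG.tsv; kernel index name
`Summit.ABC.IUTFork.DAG.N_IUTchII_Ex1_9_iv` (= the statements of `ex19iv_a ∧ ex19iv_c`, witnessed there
BY NAME).

Clause census of (iv) against the typed file (decl that carries each printed clause):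
* p. 43 l. 17–37 — input `Π ≅ Π^tp_{X̲̲_k}`, `Δ ⊆ Π`; the [AbsTopIII] Cor. 1.10 (c) isomorphism
  `μ_Ẑ(G_k) ≅ μ_Ẑ(Π_X)` "constructed by means of a functorial group-theoretic algorithm", its inverse the
  cyclotomic rigidity isomorphism `(l·Δ_Θ)(Π) ≅ μ_Ẑ(Π/Δ)`; "in summary … output data … `Π`, the two
  topological `Π`-modules, and the above isomorphism of `Π`-modules": the OUTPUT objects are
  `CyclotomePairIso` (typed); the algorithm is carried as a functor variable `Ξcyc : IsoClass Π^tp ⥤ ℱ`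
  (interface level: the L4 statement of record for the algorithm is
  `Literature.AnabelianGeometry.AbsoluteAnabelian.AbsTopIII.CurveModel.Cor_1_10_ii_c`, NOT consumed by the
  typed node). Nothing printed to prove.
* p. 43 l. 37–45 — "(a) a multiradially defined functor, via the approach of (ii)": ALREADY-PROVED
  (`ex19iv_a`); "(b) a uniradially defined functor, via the approach of (iii)": the typed file proves the
  general (iii) statement (`ex19iii_uniradiallyDefined`) for every algorithm; the printed (b) — its
  instance at the cyclotomic-rigidity algorithm — is recorded HERE as its own theorem (`ex19iv_b`), over
  the named non-fullness input `quotientFunctor_not_full` ([AbsTopIII] §I3; FACT-LIST F-0421, a predicate).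
* p. 43 l. 46 – p. 44 l. 5 — daggered radial data `(Π, G, α, (l·Δ_Θ)(Π) ≅ μ_Ẑ(G))`, the last member the
  `Γ`-orbit poly-isomorphism obtained by composing with `μ_Ẑ(Π/Δ) ≅ μ_Ẑ(G)` induced by `α`; "An
  isomorphism of collections of daggered radial data is defined to be an isomorphism between the
  underlying collections of radial data [which is necessarily compatible with the poly-isomorphism …]":
  typed as the GRAPH `ℛ†` of the daggering algorithm `Ξ† : ℛ ⥤ ℱ` out of the radial category `ℛ` of
  Example 1.8 (i) (same objects and morphisms as `ℛ`; the `Γ`-orbit, being DETERMINED by `(Π, G, α)`, is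
  the value `Ξ†(Π, G, α)` — interface level, [AbsAnab] Prop. 1.2.1 (vi) is not consumed). Residuals PROVED
  HERE: the forgetful functor `ℛ† → ℛ` is an equivalence of categories and so is `Ψ_ℛ : ℛ → ℛ†` (this is
  the precise content of "isomorphism of daggered data := isomorphism of the underlying radial data"),
  `Ψ_ℛ` followed by `ℛ† → ℛ` is the identity, and the bracketed compatibility: the `ℱ`-component of the
  image of an isomorphism `f` of radial data is `Ξ†(f)` (`ex19iv_toBase_isEquivalence`,
  `ex19iv_ΨR_isEquivalence`, `ex19iv_ΨR_toBase`, `ex19iv_dagger_compatible`).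
* p. 44 l. 5–12 — "if we take `𝒞† := 𝒞`, then the functorial group-theoretic algorithm … yields a functor
  `Ψ_ℛ : ℛ → ℛ†` …, together with a diagram as in the display of Example 1.7, (iv)": typed
  (`RadialEnvironment.dagger`, `RadialEnvironment.toDagger`); kernel probes HERE that the typed daggered
  environment of (iv) has `𝒞† = 𝒞`, `Φ† = (ℛ† → ℛ) ∘ Φ`, `Ψ_𝒞 = id`, and that the square of Example 1.7
  (iv) commutes STRICTLY, `Φ† ∘ Ψ_ℛ = Φ` (`ex19iv_dagger_C`, `ex19iv_dagger_Φ`, `ex19iv_toDagger_ΨC`,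
  `ex19iv_square`).
* p. 44 l. 12–19 — "(c) this multiradially defined functor `Ψ_ℛ : ℛ → ℛ†` yields an alternative [i.e.,
  relative to (a)] multiradial approach": ALREADY-PROVED (`ex19iv_c`); "This is the approach taken in
  Corollary 1.11, (b), below": pointer, nothing to prove.
* Node-level record `ex19iv_abc`: (a) ∧ (b) ∧ (c) for every algorithm `Ξcyc`, every quotient functor `Q`
  satisfying the named non-fullness input, and every daggering `Ξ†`.

Honest scope: Example 1.9 (iv) is bookkeeping about WHICH radial environment a given algorithm is read
through; the mathematics of the cyclotomic rigidity isomorphism itself ([AbsTopIII] Cor. 1.10, [EtTh]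
Cor. 2.18) lives in layers L2/L4 and is not touched here. Nothing in this file bears on [IUTchIII]
Cor. 3.12; nothing asserts abc proved or refuted; typed ≠ proved. Tag form
[claim: Mochizuki2012, status: disputed] records that the SENTENCES are transcribed from [IUTchII].
-/

namespace Literature.IUT.HodgeArakelov

open CategoryTheory

universe u

variable (S : ThetaSetting.{u})

/-! ## (iv) (b): the cyclotomic rigidity algorithm read through the uniradial environment of (iii) -/

/-- **IUTchII:Ex1.9(iv)** (b) (kurims p. 43 l. 37–45): "if one takes this functorial group-theoretic
algorithm [`Π ↦ (Π, (l·Δ_Θ)(Π), μ_Ẑ(Π/Δ), (l·Δ_Θ)(Π) ≅ μ_Ẑ(Π/Δ))`] to be the algorithm that gives rise to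
the functor `Ξ` in the discussion of … (iii), then one concludes that the above cyclotomic rigidity
isomorphism … may be thought of as giving rise to … (b) a uniradially defined functor, via the approach of
(iii)" — PROVED as the instance of `ex19iii_uniradiallyDefined` at the cyclotomic-rigidity functor
`Ξcyc`, over the named input "`Φ` fails to be full [cf. [AbsTopIII], §I3]" (`quotientFunctor_not_full`).
[claim: Mochizuki2012, status: disputed] (IUTchII §1 Ex 1.9 (iv), kurims p.43) -/
theorem ex19iv_b (Q : IsoClass S.PiX ⥤ IsoClass S.Gk) [Q.EssSurj] (hQ : quotientFunctor_not_full S Q)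
    {F : Type (u + 1)} [Category.{u} F] (Ξcyc : IsoClass S.PiX ⥤ F) :
    ((ex19iii S Q).toDagger Ξcyc).IsUniradiallyDefined :=
  ex19iii_uniradiallyDefined S Q hQ Ξcyc

/-! ## (iv) (c): the daggered radial data `(Π, G, α, (l·Δ_Θ)(Π) ≅ μ_Ẑ(G))` -/

section Dagger

variable {F : Type (u + 1)} [Category.{u} F] (Ξdag : (ex18i S).R ⥤ F)

/-- **IUTchII:Ex1.9(iv)** (c) (kurims p. 44 l. 5): "if we take `𝒞† := 𝒞`" — the daggered environment of
(iv) (c), as typed, has the SAME coric category as the environment `(ℛ, 𝒞, Φ)` of Example 1.8 (i)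
(kernel probe, definitional). [claim: Mochizuki2012, status: disputed] (IUTchII §1 Ex 1.9 (iv), kurims p.44) -/
theorem ex19iv_dagger_C : ((ex18i S).dagger Ξdag).C = (ex18i S).C := rfl

/-- **IUTchII:Ex1.9(iv)** (c) with (ii) (kurims p. 42, p. 44 l. 5–11): the daggered radial functor is
`Φ† : ℛ† → ℛ → 𝒞`, i.e. forget the final member `(l·Δ_Θ)(Π) ≅ μ_Ẑ(G)` and apply the radial algorithm
`(Π, G, α) ↦ G` (kernel probe, definitional). [claim: Mochizuki2012, status: disputed] (IUTchII §1 Ex 1.9 (iv), kurims p.44) -/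
theorem ex19iv_dagger_Φ :
    ((ex18i S).dagger Ξdag).Φ = Functor.Graph.toBase Ξdag ⋙ (ex18i S).Φ := rfl

/-- **IUTchII:Ex1.9(iv)** (c) (kurims p. 44 l. 7–11): "the functorial group-theoretic algorithm … yields a
functor `Ψ_ℛ : ℛ → ℛ†`", `(Π, G, α) ↦ (Π, G, α, (l·Δ_Θ)(Π) ≅ μ_Ẑ(G))` — as typed, `Ψ_ℛ` is the natural
functor `ℛ → 𝒢` of Example 1.9 (i) into the graph of the daggering algorithm (kernel probe, definitional).
[claim: Mochizuki2012, status: disputed] (IUTchII §1 Ex 1.9 (iv), kurims p.44) -/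
theorem ex19iv_toDagger_ΨR : ((ex18i S).toDagger Ξdag).ΨR = Functor.Graph.ofBase Ξdag := rfl

/-- **IUTchII:Ex1.9(iv)** (c) (kurims p. 44 l. 5–12): with `𝒞† := 𝒞` the coric leg `Ψ_𝒞` of the diagram
"as in the display of Example 1.7, (iv)" is the identity (kernel probe, definitional).
[claim: Mochizuki2012, status: disputed] (IUTchII §1 Ex 1.9 (iv), kurims p.44) -/
theorem ex19iv_toDagger_ΨC : ((ex18i S).toDagger Ξdag).ΨC = 𝟭 (ex18i S).C := rfl

/-- **IUTchII:Ex1.9(iv)** (c) (kurims p. 44 l. 11–12): "together with a diagram as in the display of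
Example 1.7, (iv)" — PROVED that for the daggered radial data the 1-commutative square
`Φ† ∘ Ψ_ℛ ≅ Ψ_𝒞 ∘ Φ` commutes STRICTLY: forgetting the final member of `Ψ_ℛ(Π, G, α)` and taking the coric
part returns `G` on the nose. [claim: Mochizuki2012, status: disputed] (IUTchII §1 Ex 1.9 (iv), kurims p.44) -/
theorem ex19iv_square :
    ((ex18i S).toDagger Ξdag).ΨR ⋙ ((ex18i S).dagger Ξdag).Φ = (ex18i S).Φ := by
  change (Functor.Graph.ofBase Ξdag ⋙ Functor.Graph.toBase Ξdag) ⋙ (ex18i S).Φ = (ex18i S).Φ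
  rw [Functor.Graph.ofBase_toBase, Functor.id_comp]

/-- **IUTchII:Ex1.9(iv)** (c) (kurims p. 44 l. 7–11): `Ψ_ℛ : ℛ → ℛ†` followed by the forgetful functor
`ℛ† → ℛ` (underlying radial data of daggered radial data) is the identity of `ℛ` — PROVED (definitional).
[claim: Mochizuki2012, status: disputed] (IUTchII §1 Ex 1.9 (iv), kurims p.44) -/
theorem ex19iv_ΨR_toBase :
    ((ex18i S).toDagger Ξdag).ΨR ⋙ Functor.Graph.toBase Ξdag = 𝟭 (ex18i S).R :=
  Functor.Graph.ofBase_toBase Ξdag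

/-- **IUTchII:Ex1.9(iv)** (c) (kurims p. 43 l. 46 – p. 44 l. 5): "An isomorphism of collections of
daggered radial data is defined to be an isomorphism between the underlying collections of radial data"
— so the forgetful functor `ℛ† → ℛ`, `(Π, G, α, (l·Δ_Θ)(Π) ≅ μ_Ẑ(G)) ↦ (Π, G, α)`, is full, faithful and
(the final member being determined by `(Π, G, α)`) essentially surjective: an EQUIVALENCE of categories —
PROVED for the typed graph model. [claim: Mochizuki2012, status: disputed] (IUTchII §1 Ex 1.9 (iv), kurims pp.43-44) -/
theorem ex19iv_toBase_isEquivalence : (Functor.Graph.toBase Ξdag).IsEquivalence := {}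

/-- **IUTchII:Ex1.9(iv)** (c) (kurims p. 43 l. 46 – p. 44 l. 11): consequently the natural functor
`Ψ_ℛ : ℛ → ℛ†`, `(Π, G, α) ↦ (Π, G, α, (l·Δ_Θ)(Π) ≅ μ_Ẑ(G))`, is itself an equivalence of categories
(full, faithful, essentially surjective) — PROVED, from the Remark 1.11.3 (i) lemmas
`Functor.Graph.ofBase_full` / `_faithful` / `_essSurj` BY NAME.
[claim: Mochizuki2012, status: disputed] (IUTchII §1 Ex 1.9 (iv), kurims pp.43-44) -/
theorem ex19iv_ΨR_isEquivalence : ((ex18i S).toDagger Ξdag).ΨR.IsEquivalence :=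
  ⟨Functor.Graph.ofBase_faithful Ξdag, Functor.Graph.ofBase_full Ξdag,
    Functor.Graph.ofBase_essSurj Ξdag⟩

/-- **IUTchII:Ex1.9(iv)** (c) (kurims p. 44 l. 2–5): "[which is necessarily compatible with the
poly-isomorphism of topological modules that constitutes the final member of the collections of daggered
radial data in question]" — PROVED in the typed model: the image in `ℱ` of an isomorphism `f` of daggered
radial data IS the isomorphism `Ξ†(f)` the algorithm assigns to the underlying isomorphism of radial data.
[claim: Mochizuki2012, status: disputed] (IUTchII §1 Ex 1.9 (iv), kurims p.44) -/
theorem ex19iv_dagger_compatible {X Y : ((ex18i S).dagger Ξdag).R} (f : X ≅ Y) :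
    (Functor.Graph.toTarget Ξdag).mapIso f = Ξdag.mapIso ((Functor.Graph.toBase Ξdag).mapIso f) :=
  rfl

end Dagger

/-! ## Node-level record: (a), (b), (c) together -/

/-- **IUTchII:Ex1.9(iv)** (kurims p. 43 l. 37 – p. 44 l. 19), the three printed conclusions together:
for every cyclotomic-rigidity algorithm `Ξcyc` on topological groups `≅ Π^tp_{X̲̲_k}`, every quotient
functor `Π ↦ Π/Δ` satisfying the named non-fullness input of (iii), and every daggering algorithm `Ξ†` on
radial data `(Π, G, α)`: "(a) a multiradially defined functor, via the approach of (ii)" ∧ "(b) a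
uniradially defined functor, via the approach of (iii)" ∧ "(c) this multiradially defined functor
`Ψ_ℛ : ℛ → ℛ†` yields an alternative multiradial approach" — PROVED (`ex19iv_a`, `ex19iv_b`, `ex19iv_c`
BY NAME). [claim: Mochizuki2012, status: disputed] (IUTchII §1 Ex 1.9 (iv), kurims pp.43-44) -/
theorem ex19iv_abc {F : Type (u + 1)} [Category.{u} F] (Ξcyc : IsoClass S.PiX ⥤ F)
    (Q : IsoClass S.PiX ⥤ IsoClass S.Gk) [Q.EssSurj] (hQ : quotientFunctor_not_full S Q)
    (Ξdag : (ex18i S).R ⥤ F) :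
    ((ex18i S).toDagger (CategoryTheory.Prod.fst _ _ ⋙ Ξcyc)).IsMultiradiallyDefined ∧
      ((ex19iii S Q).toDagger Ξcyc).IsUniradiallyDefined ∧
      ((ex18i S).toDagger Ξdag).IsMultiradiallyDefined :=
  ⟨ex19iv_a S Ξcyc, ex19iv_b S Q hQ Ξcyc, ex19iv_c S Ξdag⟩

end Literature.IUT.HodgeArakelov
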